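import Literature.NumberTheory.Automorphic.AutomorphicRepsGLSatakeFlathProofs
import Literature.NumberTheory.Automorphic.AutomorphicRepsGLCuspidalL2Step3
import HarnessLib

/-!
# The `L²`-derivative along a one-parameter subgroup is the class of the Lie derivative

Topic `NumberTheory/Automorphic`. For a function `φ = invQuot f = (g ↦ f [g⁻¹])` on `G(𝔸_K)`
which is smooth in the archimedean variable and whose Lie derivative `X φ` (`lieDeriv`, the
derivative at `t = 0` of `t ↦ φ (g exp tX)`) is BOUNDED and again of the form `invQuot f_X` with
`f, f_X ∈ ℒ²(μ)` for a finite invariant measure `μ` on the automorphic quotient, the difference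
quotients `t⁻¹ (R(exp tX) [f] - [f])` of the regular representation converge in `L²(μ)` to `[f_X]`
as `t → 0` (`tendsto_slope_rightRegular_toLp`). Consequently every CLOSED `G(𝔸_K)`-invariant
subspace of `L²(μ)` containing `[f]` contains `[f_X]` (`toLp_mem_closedSubrep_of_lieDeriv`): the
`𝔤`-action on smooth vectors of a closed invariant subspace stays inside it (Harish-Chandra 1953,
§9–10: `π_U(X) ψ = lim t⁻¹ (π(exp tX) ψ - ψ)` on differentiable vectors; Getz–Hahn 2024,
Def. 4.5 (b) and Lemma 4.4.3; Libine 2012, §7.3), here for vectors represented by smooth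
functions with bounded Lie derivative, where the `L²`-limit is dominated convergence:
`|t⁻¹ (φ (g exp tX) - φ g)| ≤ sup |X φ|` by the mean value inequality along the one-parameter
subgroup (`IsArchSmooth.hasDerivAt_expMem_smul`, `IsArchSmooth.norm_sub_le_of_lieDeriv_le`).

This is the elementary analytic step, used in Borel–Jacquet 1979, 4.6 and Getz–Hahn 2024, §6.5
(the classes of `A_G`-invariant cusp forms are smooth vectors of `L²_cusp` on which `𝔤` acts
through the Lie derivatives), of the decompositions `AutomorphicRepsGLCuspidalL2Step2`
(`formsOfL2_lie_stable`: `[X φ] ∈ Π`) and `AutomorphicRepsGLIrreducibleL2Proofs`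
(`cuspidal_closure_irreducible`); for cusp forms the boundedness of `X φ` is the named fact
`AutomorphicRepsGL.cuspidal_bounded` of `AutomorphicRepsGLCuspFormsSquareIntegrable` applied to
`X φ`, which lies in any stable space containing `φ`. Everything here is proved.

Contents (all proved):
* `RealMatrixGroup.expMem_add_smul`, `expMem_zero_smul` — `t ↦ exp tX` is a one-parameter
  subgroup of `G_∞` (from `expGL_add_smul`).
* `IsArchSmooth.hasDerivAt_expMem_smul` — for archimedean-smooth `φ`, `t ↦ φ (g exp tX)` is
  differentiable on `ℝ` with derivative `(X φ)(g exp tX)`; `IsArchSmooth.norm_sub_le_of_lieDeriv_le`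
  — the mean value bound `‖φ (g exp tX) - φ g‖ ≤ C |t|` when `‖X φ‖ ≤ C`;
  `IsArchSmooth.tendsto_slope_lieDeriv` — the difference quotients converge to `(X φ)(g)`.
* `tendsto_slope_rightRegular_toLp` — `L²`-convergence of `t⁻¹ (R(exp tX)[f] - [f])` to `[f_X]`
  (any adelic group datum and automorphy datum, any finite invariant measure).
* `toLp_mem_closedSubrep_of_lieDeriv` — closed invariant subspaces containing `[f]` contain `[f_X]`.

## References

* Harish-Chandra, *Representations of a semisimple Lie group on a Banach space. I*, Trans. AMS 75
  (1953), §9–10 (differentiable vectors, `π_U(X)`), proof of Thm. 5 (p. 229: `π_W(X)ψ =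
  lim t⁻¹ {π(exp tX)ψ - ψ} ∈ V` for closed `V`) [HarishChandraTAMS1953].
* J. R. Getz, H. Hahn, *An Introduction to Automorphic Representations*, GTM 300 (2024), §4.2,
  Def. 4.5, Lemma 4.4.3, §6.5 [GetzHahn2024].
* A. Borel, H. Jacquet, *Automorphic forms and automorphic representations*, Proc. Sympos. Pure
  Math. 33 (1979), Part 1, §4.6 [BorelJacquetCorvallis1979].
-/

open scoped MatrixGroups Matrix ContDiff Classical Topology
open NumberField Filter
open _root_.MeasureTheory

noncomputable section

namespace Literature.NumberTheory.Automorphic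

/-! ### 1. One-parameter subgroups and the derivative of `t ↦ φ (g exp tX)` -/

section OneParameter

variable {A : Type*} [NormedCommRing A] [NormedAlgebra ℝ A] [NormedAlgebra ℚ A] [CompleteSpace A]
  [StarRing A] {N : Type*} [Fintype N] [DecidableEq N] {H : RealMatrixGroup A N}

/-- `exp ((s + t) X) = exp (s X) exp (t X)` in `G_∞` (`expGL_add_smul`): `t ↦ exp tX` is a
one-parameter subgroup. Knapp, *Lie Groups Beyond an Introduction*, 0.§2, Prop. 0.11 (c). [folklore] -/
theorem RealMatrixGroup.expMem_add_smul (s t : ℝ) (X : H.lie) :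
    H.expMem ((s + t) • X) = H.expMem (s • X) * H.expMem (t • X) := by
  refine Subtype.ext ?_
  change expGL (((s + t) • X : H.lie) : Matrix N N A) =
    expGL ((s • X : H.lie) : Matrix N N A) * expGL ((t • X : H.lie) : Matrix N N A)
  exact expGL_add_smul s t (X : Matrix N N A)

/-- `exp (0 · X) = 1` in `G_∞`. Knapp, 0.§2. [folklore] -/
theorem RealMatrixGroup.expMem_zero_smul (X : H.lie) : H.expMem ((0 : ℝ) • X) = 1 := by
  refine Subtype.ext ?_
  change expGL (((0 : ℝ) • X : H.lie) : Matrix N N A) = 1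
  have h0 : (((0 : ℝ) • X : H.lie) : Matrix N N A) = 0 := by
    change (0 : ℝ) • (X : Matrix N N A) = 0
    exact zero_smul _ _
  rw [h0, expGL_zero]

variable {G : Type*} [Group G] (ι : H.carrier →* G)

open scoped Matrix.Norms.Operator in
/-- **The curve `t ↦ φ (g exp tX)` is differentiable, with derivative `(X φ)(g exp tX)`**, for
`φ` smooth in the archimedean variable: `φ (g exp tX) = φ ((g exp sX) exp ((t - s) X))`, and the
derivative at `0` of `h ↦ φ (g' exp hX)` is `(X φ)(g')` by definition of the Lie derivative (it
exists because `Y ↦ φ (g' exp Y)` is smooth on `𝔤`, composed with the line `h ↦ hX`).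
Borel–Jacquet 1979, §1.5; Harish-Chandra 1953, §7. [cite: BorelJacquetCorvallis1979, §1.5] -/
theorem IsArchSmooth.hasDerivAt_expMem_smul {φ : G → ℂ} (hφ : IsArchSmooth ι φ) (X : H.lie)
    (g : G) (s : ℝ) :
    HasDerivAt (fun t : ℝ ↦ φ (g * ι (H.expMem (t • X))))
      (lieDeriv ι X φ (g * ι (H.expMem (s • X)))) s := by
  -- Mathlib idiom (Mathlib/Algebra/Lie/OfAssociative.lean), needed to name `𝔤.toSubmodule`
  letI : LieRing (Matrix N N A) := LieRing.ofAssociativeRing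
  set g' : G := g * ι (H.expMem (s • X)) with hg'
  set v : H.lie.toSubmodule := ⟨X, X.2⟩ with hv
  -- the curve based at `g'` is differentiable at `0`; its derivative there is `(X φ)(g')`
  have hd : DifferentiableAt ℝ (fun t : ℝ ↦ φ (g' * ι (H.expMem (t • X)))) 0 := by
    have hF : DifferentiableAt ℝ (fun Y : H.lie.toSubmodule ↦ φ (g' * ι (H.expMem ⟨Y, Y.2⟩)))
        ((fun t : ℝ ↦ t • v) 0) := by
      have h0 : (fun t : ℝ ↦ t • v) 0 = 0 := zero_smul _ _
      rw [h0]
      exact ((hφ g').differentiable (by simp)).differentiableAt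
    have hL : DifferentiableAt ℝ (fun t : ℝ ↦ t • v) 0 := differentiableAt_id.smul_const _
    have hcomp : DifferentiableAt ℝ
        ((fun Y : H.lie.toSubmodule ↦ φ (g' * ι (H.expMem ⟨Y, Y.2⟩))) ∘ fun t : ℝ ↦ t • v) 0 :=
      hF.comp 0 hL
    exact hcomp
  have h0 : HasDerivAt (fun t : ℝ ↦ φ (g' * ι (H.expMem (t • X)))) (lieDeriv ι X φ g') (s - s) := by
    rw [sub_self]
    exact hd.hasDerivAt
  -- shift the base point along the one-parameter subgroup
  have key : (fun t : ℝ ↦ φ (g * ι (H.expMem (t • X)))) =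
      fun t ↦ φ (g' * ι (H.expMem ((t - s) • X))) := by
    funext t
    rw [hg', mul_assoc, ← map_mul, ← RealMatrixGroup.expMem_add_smul, add_sub_cancel]
  rw [key]
  exact h0.comp_sub_const s s

/-- **Mean value bound along a one-parameter subgroup.** If `φ` is smooth in the archimedean
variable and `‖(X φ)(g)‖ ≤ C` for all `g`, then `‖φ (g exp tX) - φ g‖ ≤ C |t|`
(`Convex.norm_image_sub_le_of_norm_hasDerivWithin_le` on `ℝ`, with
`IsArchSmooth.hasDerivAt_expMem_smul`). Borel–Jacquet 1979, §1.5. [folklore] -/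
theorem IsArchSmooth.norm_sub_le_of_lieDeriv_le {φ : G → ℂ} (hφ : IsArchSmooth ι φ) (X : H.lie)
    {C : ℝ} (hC : ∀ g, ‖lieDeriv ι X φ g‖ ≤ C) (g : G) (t : ℝ) :
    ‖φ (g * ι (H.expMem (t • X))) - φ g‖ ≤ C * |t| := by
  have h := Convex.norm_image_sub_le_of_norm_hasDerivWithin_le
    (f := fun t : ℝ ↦ φ (g * ι (H.expMem (t • X))))
    (f' := fun t : ℝ ↦ lieDeriv ι X φ (g * ι (H.expMem (t • X)))) (s := Set.univ)
    (fun x _ ↦ (hφ.hasDerivAt_expMem_smul ι X g x).hasDerivWithinAt) (fun x _ ↦ hC _)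
    convex_univ (Set.mem_univ 0) (Set.mem_univ t)
  simp only [RealMatrixGroup.expMem_zero_smul, map_one, mul_one, sub_zero, Real.norm_eq_abs] at h
  exact h

/-- **The difference quotients converge to the Lie derivative**: for `φ` smooth in the
archimedean variable, `t⁻¹ (φ (g exp tX) - φ g) → (X φ)(g)` as `t → 0`, `t ≠ 0`
(`hasDerivAt_iff_tendsto_slope`). Borel–Jacquet 1979, §1.5; Getz–Hahn 2024, Def. 4.5 (b). [folklore] -/
theorem IsArchSmooth.tendsto_slope_lieDeriv {φ : G → ℂ} (hφ : IsArchSmooth ι φ) (X : H.lie)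
    (g : G) :
    Tendsto (fun t : ℝ ↦ t⁻¹ • (φ (g * ι (H.expMem (t • X))) - φ g)) (𝓝[≠] 0)
      (𝓝 (lieDeriv ι X φ g)) := by
  have h := hφ.hasDerivAt_expMem_smul ι X g 0
  rw [RealMatrixGroup.expMem_zero_smul, map_one, mul_one, hasDerivAt_iff_tendsto_slope] at h
  refine h.congr' (eventually_nhdsWithin_of_forall fun t _ ↦ ?_)
  rw [slope_def_module, sub_zero, RealMatrixGroup.expMem_zero_smul, map_one, mul_one]

end OneParameter

/-! ### 2. `L²`-convergence of the difference quotients of the regular representation -/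

section L2

/-- The norm of the class in `L²(μ)` of `F ∈ ℒ²(μ)` is `(∫ ‖F‖²)^{1/2}` (Mathlib
`Lp.norm_toLp`, `MemLp.eLpNorm_eq_integral_rpow_norm`). [folklore] -/
theorem norm_toLp_two_eq_rpow_integral {Ω : Type*} [MeasurableSpace Ω] {μ : Measure Ω} {F : Ω → ℂ}
    (hF : MemLp F 2 μ) : ‖hF.toLp F‖ = (∫ x, ‖F x‖ ^ (2 : ℝ) ∂μ) ^ (2 : ℝ)⁻¹ := by
  rw [Lp.norm_toLp, MemLp.eLpNorm_eq_integral_rpow_norm two_ne_zero ENNReal.ofNat_ne_top hF,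
    ENNReal.toReal_ofReal (Real.rpow_nonneg (integral_nonneg fun x ↦
      Real.rpow_nonneg (norm_nonneg _) _) _)]
  norm_num

variable {K : Type} [Field K] [NumberField K] {𝒢 : AdelicGroupData K}
  {μ : Measure 𝒢.automorphicQuotient}

/-- Translating the argument of `f` on the quotient is right translation of `invQuot f`:
`f (h⁻¹ • [g⁻¹]) = invQuot f (g h)`. (D2 dictionary, `invQuot_smul` pointwise.) [folklore] -/
theorem apply_inv_smul_toAutomorphicQuotient_inv (f : 𝒢.automorphicQuotient → ℂ) (h g : 𝒢.Adelic) :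
    f (h⁻¹ • 𝒢.toAutomorphicQuotient g⁻¹) = invQuot 𝒢 f (g * h) := by
  rw [invQuot_apply, mul_inv_rev]
  rfl

/-- The difference function `t⁻¹ (f (h⁻¹ • ·) - f) - f_X` at the point `[y]`, in terms of
`φ = invQuot f`: `t⁻¹ (φ (y⁻¹ h) - φ (y⁻¹)) - invQuot f_X (y⁻¹)`. (D2 dictionary.) [folklore] -/
theorem slope_sub_apply_mk (f f_X : 𝒢.automorphicQuotient → ℂ) (h : 𝒢.Adelic) (t : ℝ)
    (y : 𝒢.Adelic) :
    (t⁻¹ • ((fun x ↦ f (h⁻¹ • x)) - f) - f_X) (QuotientGroup.mk y) =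
      t⁻¹ • (invQuot 𝒢 f (y⁻¹ * h) - invQuot 𝒢 f y⁻¹) - invQuot 𝒢 f_X y⁻¹ := by
  simp only [Pi.sub_apply, Pi.smul_apply]
  change t⁻¹ • (f (QuotientGroup.mk (h⁻¹ * y)) - f (QuotientGroup.mk y)) - f_X (QuotientGroup.mk y) = _
  simp only [invQuot_apply, mul_inv_rev, inv_inv]
  rfl

variable [SMulInvariantMeasure 𝒢.Adelic 𝒢.automorphicQuotient μ]

/-- **The difference quotient of the regular representation minus `[f_X]` is the class of the
difference function**: `t⁻¹ (R(h) [f] - [f]) - [f_X] = [t⁻¹ (f (h⁻¹ • ·) - f) - f_X]` in `L²(μ)`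
(`R(h) [f] = [f (h⁻¹ • ·)]`, Mathlib `DomMulAct.mk_smul_toLp`, and linearity of `toLp`). [folklore] -/
theorem slope_rightRegular_toLp_sub_eq {f f_X : 𝒢.automorphicQuotient → ℂ} (hf : MemLp f 2 μ)
    (hfX : MemLp f_X 2 μ) (h : 𝒢.Adelic) (t : ℝ) :
    t⁻¹ • (𝒢.rightRegular μ h (hf.toLp f) - hf.toLp f) - hfX.toLp f_X =
      (((((hf.comp_measurePreserving (measurePreserving_smul h⁻¹ μ)).sub hf).const_smul t⁻¹).sub
        hfX).toLp (t⁻¹ • ((fun x ↦ f (h⁻¹ • x)) - f) - f_X)) := by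
  have h1 : 𝒢.rightRegular μ h (hf.toLp f) =
      (hf.comp_measurePreserving (measurePreserving_smul h⁻¹ μ)).toLp (fun x ↦ f (h⁻¹ • x)) := by
    rw [AdelicGroupData.rightRegular_apply, DomMulAct.mk_smul_toLp]
  rw [h1, ← MemLp.toLp_sub, ← MemLp.toLp_const_smul, ← MemLp.toLp_sub]

variable {A : Type*} [NormedCommRing A] [NormedAlgebra ℝ A] [NormedAlgebra ℚ A] [CompleteSpace A]
  [StarRing A] {N : Type*} [Fintype N] [DecidableEq N] (𝒟 : AutomorphyDatum 𝒢 A N)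
  [IsFiniteMeasure μ]

/-- **`L²`-convergence of the difference quotients to the class of the Lie derivative.** Let `μ`
be a finite `G(𝔸_K)`-invariant measure on the automorphic quotient, `f, f_X ∈ ℒ²(μ)`, and suppose
`φ = invQuot f` is smooth in the archimedean variable with Lie derivative `X φ = invQuot f_X`
bounded by `C`. Then `t⁻¹ (R(exp tX) [f] - [f]) → [f_X]` in `L²(μ)` as `t → 0`, `t ≠ 0`: the
difference `t⁻¹ (R(exp tX)[f] - [f]) - [f_X]` is the class of the function
`[y] ↦ t⁻¹ (φ (y⁻¹ exp tX) - φ (y⁻¹)) - (X φ)(y⁻¹)` (`slope_rightRegular_toLp_sub_eq`,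
`slope_sub_apply_mk`), which tends to `0` pointwise (`IsArchSmooth.tendsto_slope_lieDeriv`) and is
bounded by `2C` (`IsArchSmooth.norm_sub_le_of_lieDeriv_le`), so its `L²`-norm
`(∫ ‖·‖²)^{1/2}` tends to `0` by dominated convergence (`μ` finite). Harish-Chandra 1953, §10
(`π_U(X) ψ = lim t⁻¹ {π(exp tX) ψ - ψ}` on differentiable vectors); Getz–Hahn 2024, Def. 4.5 (b),
§6.5. [cite: HarishChandraTAMS1953, §10 and Thm. 5 (proof, p. 229)] -/
theorem tendsto_slope_rightRegular_toLp {f f_X : 𝒢.automorphicQuotient → ℂ} (hf : MemLp f 2 μ)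
    (hfX : MemLp f_X 2 μ) (hφ : IsArchSmooth 𝒟.ofArch (invQuot 𝒢 f)) (X : 𝒟.arch.lie)
    (hX : lieDeriv 𝒟.ofArch X (invQuot 𝒢 f) = invQuot 𝒢 f_X) {C : ℝ}
    (hC : ∀ g, ‖invQuot 𝒢 f_X g‖ ≤ C) :
    Tendsto (fun t : ℝ ↦ t⁻¹ • (𝒢.rightRegular μ (𝒟.ofArch (𝒟.arch.expMem (t • X))) (hf.toLp f) -
        hf.toLp f)) (𝓝[≠] 0) (𝓝 (hfX.toLp f_X)) := by
  -- the difference functions and their classes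
  let hh : ℝ → 𝒢.Adelic := fun t ↦ 𝒟.ofArch (𝒟.arch.expMem (t • X))
  let F : ℝ → 𝒢.automorphicQuotient → ℂ := fun t ↦ t⁻¹ • ((fun x ↦ f ((hh t)⁻¹ • x)) - f) - f_X
  have hFmem : ∀ t, MemLp (F t) 2 μ := fun t ↦
    (((hf.comp_measurePreserving (measurePreserving_smul (hh t)⁻¹ μ)).sub hf).const_smul t⁻¹).sub hfX
  have hC0 : 0 ≤ C := (norm_nonneg _).trans (hC 1)
  -- pointwise bound `‖F t x‖ ≤ 2C` for `t ≠ 0`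
  have hbound : ∀ t, t ≠ 0 → ∀ x, ‖F t x‖ ≤ 2 * C := by
    intro t ht x
    obtain ⟨y, rfl⟩ := QuotientGroup.mk_surjective x
    have e : F t (QuotientGroup.mk y) =
        t⁻¹ • (invQuot 𝒢 f (y⁻¹ * hh t) - invQuot 𝒢 f y⁻¹) - invQuot 𝒢 f_X y⁻¹ :=
      slope_sub_apply_mk f f_X (hh t) t y
    rw [e]
    have hmv := hφ.norm_sub_le_of_lieDeriv_le 𝒟.ofArch X (fun g ↦ by rw [hX]; exact hC g) y⁻¹ t
    calc ‖t⁻¹ • (invQuot 𝒢 f (y⁻¹ * hh t) - invQuot 𝒢 f y⁻¹) - invQuot 𝒢 f_X y⁻¹‖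
        ≤ ‖t⁻¹ • (invQuot 𝒢 f (y⁻¹ * hh t) - invQuot 𝒢 f y⁻¹)‖ + ‖invQuot 𝒢 f_X y⁻¹‖ :=
          norm_sub_le _ _
      _ ≤ C + C := by
          refine add_le_add ?_ (hC _)
          rw [norm_smul, norm_inv, Real.norm_eq_abs]
          calc |t|⁻¹ * ‖invQuot 𝒢 f (y⁻¹ * hh t) - invQuot 𝒢 f y⁻¹‖ ≤ |t|⁻¹ * (C * |t|) :=
                mul_le_mul_of_nonneg_left hmv (inv_nonneg.mpr (abs_nonneg t))
            _ = C := by field_simp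
      _ = 2 * C := by ring
  -- pointwise limit `F t x → 0`
  have hlim : ∀ x, Tendsto (fun t ↦ F t x) (𝓝[≠] 0) (𝓝 0) := by
    intro x
    obtain ⟨y, rfl⟩ := QuotientGroup.mk_surjective x
    have e : (fun t ↦ F t (QuotientGroup.mk y)) = fun t ↦
        t⁻¹ • (invQuot 𝒢 f (y⁻¹ * hh t) - invQuot 𝒢 f y⁻¹) - invQuot 𝒢 f_X y⁻¹ :=
      funext fun t ↦ slope_sub_apply_mk f f_X (hh t) t y
    rw [e]
    have hsl := hφ.tendsto_slope_lieDeriv 𝒟.ofArch X y⁻¹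
    rw [hX] at hsl
    have := hsl.sub_const (invQuot 𝒢 f_X y⁻¹)
    rwa [sub_self] at this
  -- dominated convergence for `∫ ‖F t‖²`
  have hint : Tendsto (fun t ↦ ∫ x, ‖F t x‖ ^ (2 : ℝ) ∂μ) (𝓝[≠] 0) (𝓝 0) := by
    have h0 : (∫ _x, ‖(0 : ℂ)‖ ^ (2 : ℝ) ∂μ) = 0 := by
      rw [norm_zero, Real.zero_rpow two_ne_zero, integral_zero]
    have hdct : Tendsto (fun t ↦ ∫ x, ‖F t x‖ ^ (2 : ℝ) ∂μ) (𝓝[≠] 0)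
        (𝓝 (∫ _x, ‖(0 : ℂ)‖ ^ (2 : ℝ) ∂μ)) := by
      refine tendsto_integral_filter_of_dominated_convergence (fun _ ↦ (2 * C) ^ (2 : ℝ)) ?_ ?_
        (integrable_const _) ?_
      · exact Eventually.of_forall fun t ↦
          ((hFmem t).aestronglyMeasurable.norm.aemeasurable.pow_const _).aestronglyMeasurable
      · refine eventually_nhdsWithin_of_forall fun t ht ↦ Eventually.of_forall fun x ↦ ?_
        rw [Real.norm_eq_abs, abs_of_nonneg (Real.rpow_nonneg (norm_nonneg _) _)]
        exact Real.rpow_le_rpow (norm_nonneg _) (hbound t ht x) two_pos.le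
      · refine Eventually.of_forall fun x ↦ ?_
        exact ((hlim x).norm).rpow_const (p := (2 : ℝ)) (Or.inr two_pos.le)
    rwa [h0] at hdct
  -- pass to the `L²` norm
  rw [tendsto_iff_norm_sub_tendsto_zero]
  have hnorm : ∀ t, ‖t⁻¹ • (𝒢.rightRegular μ (hh t) (hf.toLp f) - hf.toLp f) - hfX.toLp f_X‖ =
      (∫ x, ‖F t x‖ ^ (2 : ℝ) ∂μ) ^ (2 : ℝ)⁻¹ := by
    intro t
    rw [slope_rightRegular_toLp_sub_eq hf hfX (hh t) t, norm_toLp_two_eq_rpow_integral]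
  have hc : Tendsto (fun r : ℝ ↦ r ^ (2 : ℝ)⁻¹) (𝓝 0) (𝓝 0) := by
    have := (Real.continuous_rpow_const (inv_nonneg.mpr two_pos.le)).tendsto (0 : ℝ)
    rwa [Real.zero_rpow (inv_ne_zero two_ne_zero)] at this
  exact (hc.comp hint).congr fun t ↦ (hnorm t).symm


/-- **Closed invariant subspaces are stable under the `L²`-Lie-derivative.** Under the hypotheses
of `tendsto_slope_rightRegular_toLp` (`φ = invQuot f` archimedean-smooth, `X φ = invQuot f_X`
bounded, `f, f_X ∈ ℒ²(μ)`, `μ` finite invariant), every closed `G(𝔸_K)`-invariant subspace `Q`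
of `L²(μ)` containing `[f]` contains `[f_X]`: the difference quotients `t⁻¹ (R(exp tX)[f] - [f])`
lie in `Q` and converge to `[f_X]`. Harish-Chandra 1953, proof of Thm. 5 (p. 229: `π_W(X) ψ ∈ V`
"since `V` is closed"); Libine 2012, §7.3; Getz–Hahn 2024, Prop. 4.4.2. [cite: HarishChandraTAMS1953, Thm. 5 (proof, p. 229)] -/
theorem toLp_mem_closedSubrep_of_lieDeriv {f f_X : 𝒢.automorphicQuotient → ℂ} (hf : MemLp f 2 μ)
    (hfX : MemLp f_X 2 μ) (hφ : IsArchSmooth 𝒟.ofArch (invQuot 𝒢 f)) (X : 𝒟.arch.lie)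
    (hX : lieDeriv 𝒟.ofArch X (invQuot 𝒢 f) = invQuot 𝒢 f_X) {C : ℝ}
    (hC : ∀ g, ‖invQuot 𝒢 f_X g‖ ≤ C)
    (Q : ContRepresentation.ClosedSubrep (𝒢.rightRegular μ)) (hQ : hf.toLp f ∈ Q) :
    hfX.toLp f_X ∈ Q := by
  refine Q.isClosed.mem_of_tendsto (tendsto_slope_rightRegular_toLp 𝒟 hf hfX hφ X hX hC)
    (Eventually.of_forall fun t ↦ ?_)
  exact (ContRepresentation.ClosedSubrep.mem_toSubmodule).mp
    (Q.toSubmodule.smul_of_tower_mem _ (Q.toSubmodule.sub_mem (Q.apply_mem _ hQ) hQ))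

end L2

end Literature.NumberTheory.Automorphic
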